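import Mathlib
import HarnessLib
import Summits.FinalStateConjecture.FinalStateConjecture.Statement
import Literature.Geometry.Lorentzian.BackgroundChartCalculus
import Literature.Geometry.Lorentzian.TimelikeCurveLiftLocal
import Literature.Geometry.Lorentzian.KerrConvergenceProofs
import Literature.Geometry.Lorentzian.CausalityOpennessProofs

/-!
# Crux `DrainImpliesDisperse` (stmt-FinalStateConjecture-17283), line `registered`:
# late slabs of a PROPER, PINCHED, FUTURE-ORIENTED flat chart are ACHRONAL

Companion to the landed honesty lemma `stub_honestEnd` (pure causal geometry of a proper,
future-timelike-fibred late chart) and the chart-side input of the negative lemma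
`Negative.DrainImpliesDisperse_false_of_pulsedObserverDevelopmentExists`, whose rigidity clause (A)
("asymptotically flat entire late charts have eventually achronal slabs") is here REDUCED to
properness. Let `Ψ : U → M` (`U ⊆ E4` open) be smooth, an open embedding of the late region
`{x⁰ > τ₀} ∩ U`, and for some `τ₁ > τ₀`:

* (P) PROPER at level `τ₁`: `Ψ({x⁰ ≥ τ₁})` is closed in `M`;
* (C⁰) PINCHED beyond `τ₁`: `‖(Ψ^* g − η)(x)‖ < 1/4` for `x⁰ > τ₁` (operator norm of the deviation);
* (O) FUTURE-ORIENTED beyond `τ₁`: `Ψ_* ∂₀` is future-directed for `x⁰ > τ₁`.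

Then every slab `Ψ{x⁰ = τ}`, `τ > τ₁`, is achronal in `M` (`isAchronal_slab_of_proper_pinched`).

Proof. On `U₁ := U ∩ {x⁰ > τ₁}` the chart `Φ := Ψ|U₁` is an injective smooth local diffeomorphism
(pinched components are nondegenerate: `Spacetime.isLocalDiffeomorph_of_norm_deviationExtend_lt_one`),
so `T := x⁰ ∘ Φ⁻¹` is defined on the open set `W := Φ(U₁)`. Along a future timelike curve `γ`
inside `W` the pulled-back curve `β := Φ⁻¹ ∘ γ` is differentiable with `dΦ(β') = γ'`
(`mdifferentiableAt_invFun_comp_and_mfderiv`), and `T ∘ γ = (β)⁰` has POSITIVE derivative: with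
`G := Φ^* g = η + h`, `‖h‖ < 1/4`, the vector `w := β'` satisfies `G(w, w) < 0` (timelike) and
`G(w, ∂₀) < 0` (two future timelike vectors lie in one timecone, O'Neill 1983, Lemma 5.29 ff.:
`val_lt_zero_of_isFutureDirected`), and elementary algebra (`apply_zero_pos_of_norm_sub_bilin_lt`)
gives `w⁰ > 0`. Now let `γ : [a, b] → M` be future timelike from `Ψ y₀` to `Ψ y₁` on the slab
`{x⁰ = τ}`, `τ > τ₁`, and `σ := (τ₁ + τ)/2`. The set `W_σ := Ψ{x⁰ > σ}` is open and
`F_σ := Ψ{x⁰ ≥ σ}` is closed (by (P) and injectivity: `F_σ = Ψ{x⁰ ≥ τ₁} ∖ Ψ{τ₀ < x⁰ < σ}`, the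
latter open by the open embedding). If `γ` stays in `W_σ ⊆ W`, then `T ∘ γ` is strictly increasing
on `[a, b]` (`strictMonoOn_of_deriv_pos`), contradicting `T(γ a) = T(γ b) = τ`. Otherwise let `t₁`
be the first parameter with `γ t₁ ∉ W_σ` (`t₁ > a`); by closedness `γ t₁ ∈ F_σ ∖ W_σ = Ψ{x⁰ = σ}`
still lies in `W`, so `T ∘ γ` is strictly increasing on `[a, t₁]`, giving `τ = T(γ a) < T(γ t₁) = σ
< τ` — a contradiction.

Mathlib + the Literature cone; no definitions, no named facts. References: B. O'Neill, *Semi-Riemannian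
geometry* (1983), Ch. 3, pp. 90–91; Ch. 5, Lemma 5.26, 5.29 ff.; Ch. 14, p. 413. S. G. Harris, CQG 5 (1988)
111. Line lead `prover-line-stmt-FinalStateConjecture-17283-c4-0`, 2026-08-17.
-/

noncomputable section

set_option linter.dupNamespace false -- D-0017: `Summit.<S>.<S>.…` by design

open Set Filter Function TopologicalSpace Topology
open scoped Manifold ContDiff Topology

namespace Summit.FinalStateConjecture.FinalStateConjecture.Theorems.DrainImpliesDisperse

open Literature.Geometry.Lorentzian

namespace SlabAchronal

/-! ### Algebra: pinched forms, the sign of the time component -/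

/-- **Sign of the time component of a future timelike vector in a pinched frame.** If a bilinear
form `G` on `E4` is `C⁰`-pinched, `‖G − η‖ < 1/4`, and `v` satisfies `G(v, v) < 0` and
`G(v, ∂₀) < 0`, then `v⁰ > 0`: from `G(v,v) < 0`, `2 (v⁰)² > (3/4) ‖v‖²`; from `G(v, ∂₀) < 0`,
`v⁰ > −‖v‖/4`; so `v⁰ ≤ 0` would give `(v⁰)² < ‖v‖²/16`. O'Neill 1983, Ch. 5, Lemma 5.26
(perturbative form). [cite: ONeillSemiRiemannian1983, Ch. 5, Lemma 5.26] -/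
theorem apply_zero_pos_of_norm_sub_bilin_lt {G : E4 →L[ℝ] E4 →L[ℝ] ℝ}
    (hG : ‖G - Minkowski.bilin‖ < 1 / 4) {v : E4} (htl : G v v < 0)
    (hor : G v (E4.basisVector 0) < 0) : 0 < v 0 := by
  set h : E4 →L[ℝ] E4 →L[ℝ] ℝ := G - Minkowski.bilin with hh
  have hGv : ∀ w : E4, G v w = Minkowski.bilin v w + h v w := fun w ↦ by
    rw [hh]
    show G v w = Minkowski.bilin v w + (G v w - Minkowski.bilin v w)
    ring
  -- `η(v, v) = −(v⁰)² + S`, `‖v‖² = (v⁰)² + S`, `η(v, ∂₀) = −v⁰`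
  set S : ℝ := ∑ i : Fin 3, v i.succ * v i.succ with hSdef
  have hS0 : 0 ≤ S := Finset.sum_nonneg fun i _ ↦ mul_self_nonneg _
  have hηvv : Minkowski.bilin v v = -(v 0 * v 0) + S := by rw [Minkowski.bilin_apply]
  have hnorm : ‖v‖ * ‖v‖ = v 0 * v 0 + S := by
    rw [← pow_two, EuclideanSpace.real_norm_sq_eq, Fin.sum_univ_succ, hSdef]
    simp [pow_two]
  have hηve : Minkowski.bilin v (E4.basisVector 0) = -(v 0) := by
    simp [Fin.succ_ne_zero]
  -- operator-norm bounds on `h`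
  have hne : ‖(E4.basisVector 0 : E4)‖ = 1 := by simp [E4.basisVector]
  have hvv := h.le_opNorm₂ v v
  have hve := h.le_opNorm₂ v (E4.basisVector 0)
  rw [Real.norm_eq_abs] at hvv hve
  rw [hne, mul_one] at hve
  have hn0 : 0 ≤ ‖v‖ := norm_nonneg v
  have hh0 : 0 ≤ ‖h‖ := norm_nonneg h
  have hb1 : |h v v| ≤ 1 / 4 * ‖v‖ * ‖v‖ := hvv.trans (by gcongr)
  have hb2 : |h v (E4.basisVector 0)| ≤ 1 / 4 * ‖v‖ := hve.trans (by gcongr)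
  -- rewrite the hypotheses
  rw [hGv, hηvv] at htl
  rw [hGv, hηve] at hor
  by_contra hle
  push Not at hle
  have h1 : -(1 / 4 * ‖v‖ * ‖v‖) ≤ h v v := (abs_le.mp hb1).1
  have h2 : -(1 / 4 * ‖v‖) ≤ h v (E4.basisVector 0) := (abs_le.mp hb2).1
  -- `2 (v⁰)² > (3/4) ‖v‖²`, `v⁰ > −‖v‖/4`, and `v⁰ ≤ 0`: contradiction
  have h3 : 3 / 4 * (‖v‖ * ‖v‖) < 2 * (v 0 * v 0) := by linarith
  have h4 : -(1 / 4 * ‖v‖) < v 0 := by linarith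
  nlinarith [mul_nonneg hn0 hn0, mul_le_mul_of_nonneg_left hle hn0]

/-! ### Charts restricted along inclusions of open sets -/

/-- Chain rule for velocities: `(f ∘ γ)'(t) = df_{γ t}(γ' t)` (local copy of the private
`velocity_comp'` of `…StubHonestEnd`). [folklore] -/
private theorem velocity_comp' {E' : Type*} [NormedAddCommGroup E'] [NormedSpace ℝ E']
    {H' : Type*} [TopologicalSpace H'] {I' : ModelWithCorners ℝ E' H'} {N : Type*}
    [TopologicalSpace N] [ChartedSpace H' N]
    {E : Type*} [NormedAddCommGroup E] [NormedSpace ℝ E] {H : Type*} [TopologicalSpace H]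
    {I : ModelWithCorners ℝ E H} {M : Type*} [TopologicalSpace M] [ChartedSpace H M]
    {f : N → M} {γ : ℝ → N} {t : ℝ} (hf : MDifferentiableAt I' I f (γ t))
    (hγ : MDifferentiableAt 𝓘(ℝ, ℝ) I' γ t) :
    velocity I (f ∘ γ) t = mfderiv I' I f (γ t) (velocity I' γ t) := by
  simp only [velocity]
  rw [mfderiv_comp t hf hγ]
  rfl

/-- **Differential of a restricted chart.** For open `U' ≤ U ⊆ E4` and a smooth `Ψ : U → M`,
`d(Ψ ∘ ι)_x = dΨ_{ι x}` (the inclusion `ι : U' → U` has identity differential).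
O'Neill 1983, Ch. 1, p. 4 (open submanifolds). [cite: ONeillSemiRiemannian1983, Ch. 1, p. 4] -/
theorem mfderiv_comp_inclusion_apply {𝓢 : Spacetime 4} {U U' : Opens E4} (h : U' ≤ U)
    {Ψ : U → 𝓢.carrier} (hΨ : ContMDiff 𝓘(ℝ, E4) (𝓡 4) ∞ Ψ) (x : U') (v : E4) :
    mfderiv 𝓘(ℝ, E4) (𝓡 4) (Ψ ∘ Opens.inclusion h) x v =
      mfderiv 𝓘(ℝ, E4) (𝓡 4) Ψ (Opens.inclusion h x) v := by
  have hΨd : MDifferentiableAt 𝓘(ℝ, E4) (𝓡 4) Ψ (Opens.inclusion h x) :=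
    (hΨ.mdifferentiable (by simp)) _
  have hid : MDifferentiableAt 𝓘(ℝ, E4) 𝓘(ℝ, E4) (Opens.inclusion h) x :=
    ((contMDiff_inclusion (I := 𝓘(ℝ, E4)) (n := ∞) h).mdifferentiable (by simp)) x
  have h3 := DFunLike.congr_fun (mfderiv_comp x hΨd hid) v
  exact h3.trans (congrArg (mfderiv 𝓘(ℝ, E4) (𝓡 4) Ψ (Opens.inclusion h x))
    (OpensChart.mfderiv_inclusion_apply h x v))

/-- **Deviation of a restricted chart.** For open `U' ≤ U ⊆ E4` and a smooth `Ψ : U → M`, the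
deviation of `Ψ ∘ ι` from the Minkowski background on `U'` at `x` is the deviation of `Ψ` from the
Minkowski background on `U` at `ι x`. DHRT arXiv:2104.08222, §1. [cite: arXiv210408222, §1] -/
theorem deviation_comp_inclusion {𝓢 : Spacetime 4} {U U' : Opens E4} (h : U' ≤ U)
    {Ψ : U → 𝓢.carrier} (hΨ : ContMDiff 𝓘(ℝ, E4) (𝓡 4) ∞ Ψ) (x : U') :
    𝓢.deviation (Minkowski.backgroundOn U') (Ψ ∘ Opens.inclusion h) x =
      𝓢.deviation (Minkowski.backgroundOn U) Ψ (Opens.inclusion h x) := by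
  refine ContinuousLinearMap.ext fun v ↦ ContinuousLinearMap.ext fun w ↦ ?_
  rw [Spacetime.deviation_apply, Spacetime.deviation_apply]
  have e := congrArg₂ (fun u u' ↦ 𝓢.metric.val (Ψ (Opens.inclusion h x)) u u')
    (mfderiv_comp_inclusion_apply h hΨ x v) (mfderiv_comp_inclusion_apply h hΨ x w)
  exact congrArg (fun r : ℝ ↦ r - Minkowski.bilin v w) e

end SlabAchronal

open SlabAchronal

/-- **Late slabs of a proper, pinched, future-oriented flat chart are achronal.** Let
`Ψ : U → M` (`U ⊆ E4` open) be smooth and an open embedding of the late region `{x⁰ > τ₀} ∩ U`,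
and let `τ₀ < τ₁` be such that (P) `Ψ{x⁰ ≥ τ₁}` is closed in `M`, (C⁰) `‖(Ψ^* g − η)(x)‖ < 1/4` for
`x⁰ > τ₁`, and (O) `Ψ_* ∂₀` is future-directed for `x⁰ > τ₁`. Then for every `τ > τ₁` the slab
`Ψ({x⁰ = τ} ∩ U)` is achronal: no two of its points are joined by a future timelike curve of `M`.
(The chart time `x⁰ ∘ Ψ⁻¹` is strictly increasing along future timelike curves inside
`Ψ{x⁰ > τ₁}` — pinching and the timecone lemma — and by properness a timelike curve leaving that
region from a slab `{x⁰ = τ}` first meets the lower slab `{x⁰ = (τ₁ + τ)/2}`, where the chart time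
would have to be smaller; module docstring.) O'Neill 1983, Ch. 5, Lemma 5.26, 5.29 ff.; Ch. 14,
p. 413. [cite: ONeillSemiRiemannian1983, Ch. 14, p. 413] -/
theorem isAchronal_slab_of_proper_pinched : ∀ (𝓢 : Spacetime 4) (U : TopologicalSpace.Opens E4) (Ψ : U → 𝓢.carrier) (τ₀ τ₁ : ℝ), τ₀ < τ₁ → ContMDiff 𝓘(ℝ, E4) (𝓡 4) ∞ Ψ → IsOpenEmbedding (((Minkowski.backgroundOn U).lateRegion τ₀).restrict Ψ) → IsClosed (Ψ '' {x : U | τ₁ ≤ (x : E4) 0}) → (∀ x : U, τ₁ < (x : E4) 0 → ‖𝓢.deviation (Minkowski.backgroundOn U) Ψ x‖ < 1 / 4) → (∀ x : U, τ₁ < (x : E4) 0 → 𝓢.timeOrientation.IsFutureDirected (mfderiv 𝓘(ℝ, E4) (𝓡 4) Ψ x (E4.basisVector 0))) → ∀ τ : ℝ, τ₁ < τ → 𝓢.metric.IsAchronal 𝓢.timeOrientation (Ψ '' (Minkowski.backgroundOn U).timeSlab τ) := by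
  intro 𝓢 U Ψ τ₀ τ₁ h01 hsm hemb hcl hpin hfut τ hτ
  rintro _ ⟨y₀, hy₀, rfl⟩ _ ⟨y₁, hy₁, rfl⟩ hchr
  have hy₀τ : (y₀ : E4) 0 = τ := hy₀
  have hy₁τ : (y₁ : E4) 0 = τ := hy₁
  have hy₀1 : τ₁ < (y₀ : E4) 0 := by rw [hy₀τ]; exact hτ
  have hy₁1 : τ₁ < (y₁ : E4) 0 := by rw [hy₁τ]; exact hτ
  obtain ⟨p, hp, γ, a, b, hab, hγ, hγa, hγb⟩ := hchr
  rw [mem_singleton_iff] at hp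
  subst hp
  -- the open set `U₁ = U ∩ {x⁰ > τ₁}` and the restricted chart `Φ`
  have hc0 : Continuous fun z : E4 ↦ z 0 := PiLp.continuous_apply 2 _ 0
  let U₁ : Opens E4 :=
    ⟨{z : E4 | z ∈ (U : Set E4) ∧ τ₁ < z 0}, U.2.inter (isOpen_lt continuous_const hc0)⟩
  have hle : U₁ ≤ U := fun z hz ↦ hz.1
  let Φ : (Minkowski.backgroundOn U₁).domain → 𝓢.carrier := Ψ ∘ Opens.inclusion hle
  have hΦsm : ContMDiff 𝓘(ℝ, E4) (𝓡 4) ∞ Φ := hsm.comp (contMDiff_inclusion hle)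
  have hlate : ∀ z : U₁, Opens.inclusion hle z ∈ (Minkowski.backgroundOn U).lateRegion τ₀ :=
    fun z ↦ h01.trans z.2.2
  have hinj : Injective Φ := by
    intro z z' hzz'
    have h1 := hemb.injective
      (a₁ := ⟨Opens.inclusion hle z, hlate z⟩) (a₂ := ⟨Opens.inclusion hle z', hlate z'⟩) hzz'
    exact Subtype.ext (congrArg (fun w : U ↦ (w : E4)) (congrArg Subtype.val h1))
  have hΨΦ : ∀ (x : U) (hx : τ₁ < (x : E4) 0), Ψ x = Φ ⟨(x : E4), x.2, hx⟩ := fun x hx ↦ rfl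
  -- pinching transferred to `Φ`; `Φ` is a local diffeomorphism with open range
  have hdevΦ : ∀ z : U₁, ‖𝓢.deviation (Minkowski.backgroundOn U₁) Φ z‖ < 1 / 4 := fun z ↦
    (congrArg norm (deviation_comp_inclusion hle hsm z)).trans_lt (hpin _ z.2.2)
  have hloc : IsLocalDiffeomorph 𝓘(ℝ, E4) (𝓡 4) ∞ Φ :=
    𝓢.isLocalDiffeomorph_of_norm_deviationExtend_lt_one Φ hΦsm fun y hy ↦
      (congrArg norm (𝓢.deviationExtend_coe (Minkowski.backgroundOn U₁) Φ ⟨y, hy⟩)).trans_lt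
        ((hdevΦ ⟨y, hy⟩).trans (by norm_num))
  have hWΦ : ∀ {s : Set U₁}, IsOpen s → IsOpen (Φ '' s) := fun hs ↦ hloc.isOpenMap _ hs
  -- the chart time `T = x⁰ ∘ Φ⁻¹`
  haveI hne : Nonempty (Minkowski.backgroundOn U₁).domain := ⟨⟨(y₀ : E4), y₀.2, hy₀1⟩⟩
  let T : 𝓢.carrier → ℝ := fun q ↦
    ((Function.invFun Φ q : (Minkowski.backgroundOn U₁).domain) : E4) 0
  have hTΦ : ∀ z : (Minkowski.backgroundOn U₁).domain, T (Φ z) = (z : E4) 0 := fun z ↦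
    congrArg (fun u : (Minkowski.backgroundOn U₁).domain ↦ (u : E4) 0)
      (Function.leftInverse_invFun hinj z)
  have hTΨ : ∀ (x : U) (hx : τ₁ < (x : E4) 0), T (Ψ x) = (x : E4) 0 := fun x hx ↦ by
    rw [hΨΦ x hx, hTΦ]
  -- `T ∘ γ` has positive derivative wherever `γ` is future timelike inside `range Φ`
  have hderiv : ∀ t : ℝ, MDifferentiableAt 𝓘(ℝ, ℝ) (𝓡 4) γ t → γ t ∈ range Φ →
      𝓢.metric.IsTimelike (velocity (𝓡 4) γ t) →
      𝓢.timeOrientation.IsFutureDirected (velocity (𝓡 4) γ t) →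
      ∃ d : ℝ, 0 < d ∧ HasDerivAt (T ∘ γ) d t := by
    intro t hγd hγt htl hfd
    obtain ⟨hβd, hΦβ, hv⟩ := mdifferentiableAt_invFun_comp_and_mfderiv hΦsm hinj hloc hγd hγt
    set β : ℝ → (Minkowski.backgroundOn U₁).domain := Function.invFun Φ ∘ γ with hβdef
    set w : E4 := velocity 𝓘(ℝ, E4) β t with hw
    -- derivative of `T ∘ γ = x⁰ ∘ val ∘ β`
    have hvalsm : MDifferentiableAt 𝓘(ℝ, E4) 𝓘(ℝ, E4)
        (Subtype.val : (Minkowski.backgroundOn U₁).domain → E4) (β t) :=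
      ((contMDiff_subtype_val (I := 𝓘(ℝ, E4)) (n := ∞)).mdifferentiable (by simp)) _
    have hvβ : MDifferentiableAt 𝓘(ℝ, ℝ) 𝓘(ℝ, E4) (Subtype.val ∘ β) t := hvalsm.comp t hβd
    have hvel : velocity 𝓘(ℝ, E4) (Subtype.val ∘ β) t = w := by
      rw [hw, velocity_comp' hvalsm hβd]
      exact OpensChart.mfderiv_subtypeVal_apply (β t) _
    have hd1 : HasDerivAt (Subtype.val ∘ β) w t := by
      have h1 : DifferentiableAt ℝ (Subtype.val ∘ β) t :=
        mdifferentiableAt_iff_differentiableAt.mp hvβ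
      have h3 : deriv (Subtype.val ∘ β) t = w := by
        rw [← hvel]
        simp only [velocity, mfderiv_eq_fderiv]
        rfl
      exact h3 ▸ h1.hasDerivAt
    have hT : T ∘ γ = (EuclideanSpace.proj (0 : Fin 4) : E4 →L[ℝ] ℝ) ∘ (Subtype.val ∘ β) := rfl
    have hd2 : HasDerivAt (T ∘ γ) (w 0) t := by
      rw [hT]
      exact (EuclideanSpace.proj (0 : Fin 4) : E4 →L[ℝ] ℝ).hasFDerivAt.comp_hasDerivAt t hd1
    refine ⟨w 0, ?_, hd2⟩
    -- the sign: `G := Φ^* g = η + dev` at `β t`, `w` timelike future, `∂₀` timelike future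
    set G : E4 →L[ℝ] E4 →L[ℝ] ℝ :=
      𝓢.deviation (Minkowski.backgroundOn U₁) Φ (β t) + Minkowski.bilin with hGdef
    have hGsub : G - Minkowski.bilin = 𝓢.deviation (Minkowski.backgroundOn U₁) Φ (β t) := by
      rw [hGdef]
      exact add_sub_cancel_right (𝓢.deviation (Minkowski.backgroundOn U₁) Φ (β t)) Minkowski.bilin
    have hGn : ‖G - Minkowski.bilin‖ < 1 / 4 := by rw [hGsub]; exact hdevΦ (β t)
    have hG : ∀ u u' : E4, G u u' = 𝓢.metric.val (Φ (β t)) (mfderiv 𝓘(ℝ, E4) (𝓡 4) Φ (β t) u)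
        (mfderiv 𝓘(ℝ, E4) (𝓡 4) Φ (β t) u') := by
      intro u u'
      show 𝓢.deviation (Minkowski.backgroundOn U₁) Φ (β t) u u' + Minkowski.bilin u u' = _
      rw [Spacetime.deviation_apply]
      exact sub_add_cancel _ _
    -- the curve data at the base point `Φ (β t) = γ t`, vector `dΦ w = γ' t`
    have hgen : ∀ q, q = γ t →
        𝓢.metric.val q (velocity (𝓡 4) γ t) (velocity (𝓡 4) γ t) < 0 ∧
        𝓢.metric.val q (𝓢.timeOrientation.vectorField q) (velocity (𝓡 4) γ t) < 0 := by
      rintro q rfl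
      exact ⟨htl, hfd.2⟩
    obtain ⟨h1, h2⟩ := hgen _ hΦβ
    rw [← hv] at h1 h2
    -- `∂₀` data at the same base point (transport from `Ψ` at `ι (β t)` to `Φ` at `β t`)
    have hgen2 : ∀ (q : 𝓢.carrier) (u : E4), q = Ψ (Opens.inclusion hle (β t)) →
        u = mfderiv 𝓘(ℝ, E4) (𝓡 4) Ψ (Opens.inclusion hle (β t)) (E4.basisVector 0) →
        𝓢.metric.val q (𝓢.timeOrientation.vectorField q) u < 0 := by
      rintro q u rfl rfl
      exact (hfut _ (β t).2.2).2
    have hTe : 𝓢.metric.val (Φ (β t)) (𝓢.timeOrientation.vectorField (Φ (β t)))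
        (mfderiv 𝓘(ℝ, E4) (𝓡 4) Φ (β t) (E4.basisVector 0)) < 0 :=
      hgen2 _ _ rfl (mfderiv_comp_inclusion_apply hle hsm (β t) _)
    have he1 : 𝓢.metric.val (Φ (β t)) (mfderiv 𝓘(ℝ, E4) (𝓡 4) Φ (β t) (E4.basisVector 0))
        (mfderiv 𝓘(ℝ, E4) (𝓡 4) Φ (β t) (E4.basisVector 0)) < 0 := by
      rw [← hG]
      exact Minkowski.apply_basisVector_zero_neg_of_norm_sub_bilin_lt_one (hGn.trans (by norm_num))
    -- timecone lemma: `g(γ', Φ_*∂₀) < 0`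
    have hor := LorentzianMetric.val_lt_zero_of_isFutureDirected 𝓢.timeOrientation h1 h2 he1 hTe
    rw [← hG] at h1 hor
    exact apply_zero_pos_of_norm_sub_bilin_lt hGn h1 hor
  -- strict monotonicity of `T ∘ γ` on initial segments staying in `range Φ`
  have hmono : ∀ c, a < c → c ≤ b → (∀ s ∈ Icc a c, γ s ∈ range Φ) → T (γ a) < T (γ c) := by
    intro c hac hcb hin
    have hd : ∀ s ∈ Icc a c, ∃ d, 0 < d ∧ HasDerivAt (T ∘ γ) d s := fun s hs ↦
      hderiv s (hγ s ⟨hs.1, hs.2.trans hcb⟩).1 (hin s hs) (hγ s ⟨hs.1, hs.2.trans hcb⟩).2.1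
        (hγ s ⟨hs.1, hs.2.trans hcb⟩).2.2
    have hcts : ContinuousOn (T ∘ γ) (Icc a c) := fun s hs ↦
      (hd s hs).choose_spec.2.continuousAt.continuousWithinAt
    have hpos : ∀ s ∈ interior (Icc a c), 0 < deriv (T ∘ γ) s := by
      intro s hs
      rw [interior_Icc] at hs
      obtain ⟨d, hdpos, hds⟩ := hd s (Ioo_subset_Icc_self hs)
      rwa [hds.deriv]
    exact strictMonoOn_of_deriv_pos (convex_Icc a c) hcts hpos (left_mem_Icc.2 hac.le)
      (right_mem_Icc.2 hac.le) hac
  -- the level `σ` strictly between `τ₁` and `τ`; `W_σ` open, `F_σ` closed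
  obtain ⟨σ, hσ1, hστ⟩ : ∃ σ : ℝ, τ₁ < σ ∧ σ < τ := ⟨(τ₁ + τ) / 2, by linarith, by linarith⟩
  have hWσ_open : IsOpen (Φ '' {z : U₁ | σ < (z : E4) 0}) :=
    hWΦ (isOpen_lt continuous_const (hc0.comp continuous_subtype_val))
  have hFσ : IsClosed (Ψ '' {x : U | σ ≤ (x : E4) 0}) := by
    have hVopen : IsOpen (Ψ '' {x : U | τ₀ < (x : E4) 0 ∧ (x : E4) 0 < σ}) := by
      have h1 : IsOpen {y : (Minkowski.backgroundOn U).lateRegion τ₀ | ((y.1 : U) : E4) 0 < σ} :=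
        isOpen_lt ((hc0.comp continuous_subtype_val).comp continuous_subtype_val) continuous_const
      have h2 := hemb.isOpenMap _ h1
      convert h2 using 1
      ext q
      constructor
      · rintro ⟨x, ⟨hx1, hx2⟩, rfl⟩
        exact ⟨⟨x, hx1⟩, hx2, rfl⟩
      · rintro ⟨⟨x, hx1⟩, hx2, rfl⟩
        exact ⟨x, ⟨hx1, hx2⟩, rfl⟩
    have heq : Ψ '' {x : U | σ ≤ (x : E4) 0} =
        Ψ '' {x : U | τ₁ ≤ (x : E4) 0} ∩ (Ψ '' {x : U | τ₀ < (x : E4) 0 ∧ (x : E4) 0 < σ})ᶜ := by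
      ext q
      constructor
      · rintro ⟨x, hx, rfl⟩
        have hx' : σ ≤ (x : E4) 0 := hx
        refine ⟨⟨x, show τ₁ ≤ (x : E4) 0 from hσ1.le.trans hx', rfl⟩, ?_⟩
        rintro ⟨x', ⟨hx'1, hx'2⟩, hxx'⟩
        have hxl : x ∈ (Minkowski.backgroundOn U).lateRegion τ₀ :=
          show τ₀ < (x : E4) 0 from h01.trans_le (hσ1.le.trans hx')
        have h1 := hemb.injective (a₁ := ⟨x', hx'1⟩) (a₂ := ⟨x, hxl⟩) hxx'
        have hx'x : x' = x := congrArg Subtype.val h1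
        have hlt : (x : E4) 0 < σ := hx'x ▸ hx'2
        exact absurd (lt_of_le_of_lt hx' hlt) (lt_irrefl _)
      · rintro ⟨⟨x, hx, rfl⟩, hnot⟩
        exact ⟨x, show σ ≤ (x : E4) 0 from le_of_not_gt fun hlt ↦
          hnot ⟨x, ⟨show τ₀ < (x : E4) 0 from h01.trans_le hx, hlt⟩, rfl⟩, rfl⟩
    rw [heq]
    exact hcl.inter hVopen.isClosed_compl
  -- bookkeeping on `W_σ`
  have hWσW : Φ '' {z : U₁ | σ < (z : E4) 0} ⊆ range Φ := by
    rintro _ ⟨z, -, rfl⟩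
    exact mem_range_self z
  have hWσF : Φ '' {z : U₁ | σ < (z : E4) 0} ⊆ Ψ '' {x : U | σ ≤ (x : E4) 0} := by
    rintro _ ⟨z, hz, rfl⟩
    have hz' : σ < (z : E4) 0 := hz
    exact ⟨Opens.inclusion hle z, show σ ≤ (z : E4) 0 from le_of_lt hz', rfl⟩
  have hcont : ∀ s ∈ Icc a b, ContinuousAt γ s := fun s hs ↦ (hγ s hs).1.continuousAt
  have hγaW : γ a ∈ Φ '' {z : U₁ | σ < (z : E4) 0} :=
    ⟨⟨y₀, y₀.2, hy₀1⟩, show σ < (y₀ : E4) 0 by rw [hy₀τ]; exact hστ,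
      ((hΨΦ y₀ hy₀1).symm.trans hγa.symm)⟩
  by_cases hall : ∀ s ∈ Icc a b, γ s ∈ Φ '' {z : U₁ | σ < (z : E4) 0}
  · -- `γ` stays in `W_σ ⊆ range Φ`: `τ = T(γ a) < T(γ b) = τ`
    have h := hmono b hab le_rfl fun s hs ↦ hWσW (hall s hs)
    rw [hγa, hγb, hTΨ y₀ hy₀1, hTΨ y₁ hy₁1, hy₀τ, hy₁τ] at h
    exact lt_irrefl _ h
  · push Not at hall
    -- the first exit parameter `t₁` from `W_σ`
    set S : Set ℝ := {s | s ∈ Icc a b ∧ γ s ∉ Φ '' {z : U₁ | σ < (z : E4) 0}} with hSdef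
    have hSne : S.Nonempty := by
      obtain ⟨s, hs, hsW⟩ := hall
      exact ⟨s, hs, hsW⟩
    have hSbdd : BddBelow S := ⟨a, fun s hs ↦ hs.1.1⟩
    have hSclosed : IsClosed S := by
      have hco : ContinuousOn γ (Icc a b) := fun s hs ↦ (hcont s hs).continuousWithinAt
      exact hco.preimage_isClosed_of_isClosed isClosed_Icc hWσ_open.isClosed_compl
    have ht₁S : sInf S ∈ S := hSclosed.csInf_mem hSne hSbdd
    set t₁ : ℝ := sInf S with ht₁def
    have ht₁ab : t₁ ∈ Icc a b := ht₁S.1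
    have hat₁ : a < t₁ := by
      rcases eq_or_lt_of_le ht₁ab.1 with h | h
      · exact absurd (h ▸ hγaW) ht₁S.2
      · exact h
    have hbefore : ∀ s ∈ Ico a t₁, γ s ∈ Φ '' {z : U₁ | σ < (z : E4) 0} := by
      intro s hs
      by_contra hsW
      have hsS : s ∈ S := ⟨⟨hs.1, hs.2.le.trans ht₁ab.2⟩, hsW⟩
      exact absurd (csInf_le hSbdd hsS) (not_le.2 hs.2)
    -- `γ t₁ ∈ F_σ` by closedness
    have hγt₁F : γ t₁ ∈ Ψ '' {x : U | σ ≤ (x : E4) 0} := by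
      have htend : Tendsto γ (𝓝[<] t₁) (𝓝 (γ t₁)) :=
        (hcont t₁ ht₁ab).tendsto.mono_left nhdsWithin_le_nhds
      have hev : ∀ᶠ s in 𝓝[<] t₁, γ s ∈ Ψ '' {x : U | σ ≤ (x : E4) 0} := by
        filter_upwards [Ioo_mem_nhdsLT hat₁] with s hs
        exact hWσF (hbefore s ⟨hs.1.le, hs.2⟩)
      exact hFσ.mem_of_tendsto htend hev
    obtain ⟨z, hzσ, hzγ⟩ := hγt₁F
    have hz1 : τ₁ < (z : E4) 0 := hσ1.trans_le hzσ
    have hΦz : Φ ⟨(z : E4), z.2, hz1⟩ = γ t₁ := (hΨΦ z hz1).symm.trans hzγ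
    -- `γ t₁ ∉ W_σ` forces `z⁰ = σ`
    have hzσ' : (z : E4) 0 = σ := by
      refine le_antisymm (le_of_not_gt fun hlt ↦ ?_) hzσ
      exact ht₁S.2 ⟨⟨(z : E4), z.2, hz1⟩, show σ < (z : E4) 0 from hlt, hΦz⟩
    -- but `T` increases strictly along `γ` on `[a, t₁]`
    have hin : ∀ s ∈ Icc a t₁, γ s ∈ range Φ := by
      intro s hs
      rcases eq_or_lt_of_le hs.2 with h | h
      · rw [h, ← hΦz]
        exact mem_range_self _
      · exact hWσW (hbefore s ⟨hs.1, h⟩)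
    have h := hmono t₁ hat₁ ht₁ab.2 hin
    rw [hγa, hTΨ y₀ hy₀1, hy₀τ, ← hzγ, hTΨ z hz1, hzσ'] at h
    exact absurd (hστ.trans h) (lt_irrefl _)

end Summit.FinalStateConjecture.FinalStateConjecture.Theorems.DrainImpliesDisperse

end
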